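import Summits.Ventures.QEC.Census.CertInfoSetOrbitStabFast
import Summits.Ventures.QEC.Census.CertCheckParityFast
import Summits.Ventures.QEC.Census.CertBZPlaneSound
import Summits.Ventures.QEC.Census.TwoBGA.S8_2x2x30_w6_k16_000003.Cert
import HarnessLib

/-!
# `S8_2x2x30_w6_k16_000003` — checks module `ChecksA` (est 110 s) of the KERNEL-std certificate of census row `S8_2x2x30_w6_k16_000003` (qec-search-4 g6 orbit-stabilized lane)

structural checks (commutation via `commOKR`, witnesses, allow-lists), rank certificates, the masked profile checks `orbitProfileOKM` and plain-view RREF checks; assembled in `Census/TwoBGA/S8_2x2x30_w6_k16_000003/Distance.lean`.  Generated by `emit_stab_row.py`; do not edit by hand.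
-/

set_option autoImplicit false
set_option Elab.async false

namespace Summit.Ventures.QEC.Census.S8_2x2x30_w6_k16_000003

open Matrix Literature.InformationTheory.QuantumCodes Summit.Ventures.QEC.Census

/-- Commutation through the RREF of the first `Z` view (qec-search-4 `commOKR`). -/
theorem comm_ok : commOKR S8_2x2x30_w6_k16_000003.cert.n S8_2x2x30_w6_k16_000003.cert.HX S8_2x2x30_w6_k16_000003.cert.HZ S8_2x2x30_w6_k16_000003.svZ0.ic = true := by
  decide +kernel

/-- Commutation, both upper witnesses (weights 12/12) with non-membership witnesses, both allow-lists (`checkStructure_of_parts`). -/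
theorem checkStructure_ok : S8_2x2x30_w6_k16_000003.cert.checkStructure = true :=
  S8_2x2x30_w6_k16_000003.cert.checkStructure_of_parts (by decide) (commOK_of_comm (comm_of_commOKR comm_ok))
    (by decide +kernel) (by decide +kernel) (by decide +kernel) (by decide +kernel) (by decide +kernel) (by decide +kernel)

/-- Rank certificate of `H^X` (`r = 112`). -/
theorem rankX_ok : S8_2x2x30_w6_k16_000003.rcX.check S8_2x2x30_w6_k16_000003.cert.n S8_2x2x30_w6_k16_000003.cert.HX = true :=
  RankCert.check_of_checkQ (by decide) (by decide +kernel)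

/-- Rank certificate of `H^Z` (`r = 112`). -/
theorem rankZ_ok : S8_2x2x30_w6_k16_000003.rcZ.check S8_2x2x30_w6_k16_000003.cert.n S8_2x2x30_w6_k16_000003.cert.HZ = true :=
  RankCert.check_of_checkQ (by decide) (by decide +kernel)

/-- **The `Z`-side masked profile check** at threshold `11` (120 automorphisms; depths [5]; masks of sizes [130]). -/
theorem profZ_ok : orbitProfileOKM S8_2x2x30_w6_k16_000003.cert.n (S8_2x2x30_w6_k16_000003.cert.dZ - 1) (autPerms S8_2x2x30_w6_k16_000003.gensZ) S8_2x2x30_w6_k16_000003.wordsZ S8_2x2x30_w6_k16_000003.masksZ S8_2x2x30_w6_k16_000003.viewsZ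
    S8_2x2x30_w6_k16_000003.clsZ S8_2x2x30_w6_k16_000003.muZ = true := by
  decide +kernel

/-- **The `X`-side masked profile check** at threshold `11` (120 automorphisms; depths [5, 5]; masks of sizes [130, 130]). -/
theorem profX_ok : orbitProfileOKM S8_2x2x30_w6_k16_000003.cert.n (S8_2x2x30_w6_k16_000003.cert.dX - 1) (autPerms S8_2x2x30_w6_k16_000003.gensX) S8_2x2x30_w6_k16_000003.wordsX S8_2x2x30_w6_k16_000003.masksX S8_2x2x30_w6_k16_000003.viewsX
    S8_2x2x30_w6_k16_000003.clsX S8_2x2x30_w6_k16_000003.muX = true := by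
  decide +kernel

end Summit.Ventures.QEC.Census.S8_2x2x30_w6_k16_000003
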